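import Literature.MathematicalPhysics.QuantumFieldTheory.Balaban1983to89.B4Thm110ZeroBoxDeriv

/-!
# `Balaban1983to89.B4Thm110ZeroBoxMeshOne` — B4 «Theorem (Proposition 2.1 of [1])» (1.10) at `A = 0` on boxes,
# THE MESH-ONE MEMBER `k = 0` (`η = L⁰ = 1`, `P₀ = Q₀^*Q₀ = 1`): `G₀(□) = (−Δ^N_□ + m² + a)⁻¹`, its entry decay
# ([B4] Lemma 2.4 (2.35) at `j = 0` / Lemma 5.2 (5.7), Combes–Thomas BY NAME), the weighted-row VALUE and DERIVATIVE
# clauses, and the ALL-SCALES forms of `thm110_zero_box_roww_coeff` / `thm110_zero_box_deriv_roww_coeff` (`k ≥ 0`)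

statement-level skeleton of published theorems with citation tags; proofs where landed; nothing here is a claim about the Yang–Mills mass gap

**Source.** T. Bałaban, *Regularity and Decay of Lattice Green's Functions*, Commun. Math. Phys. **89**, 571–597 (1983)
(bib key `Balaban1983RegularityDecay`, «B4»): p. 572 [PDF 2] (1.3)–(1.6), p. 573 [PDF 3] the Theorem (1.9)–(1.10),
p. 578 [PDF 8] Lemma 2.2 (2.17), p. 582 [PDF 12] Lemma 2.4 (2.35) «for arbitrary non-negative integer j», p. 584
[PDF 14] (2.44), p. 594 [PDF 24] Lemma 5.2 (5.6)–(5.7) (journal page = PDF page + 570; renders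
`b2b-balaban-ref1/pages/1983-cmp89-regularity-decay/…-p002-x2.png`, `-p003`, `-p012`, `-p014`, `-p024`, read as
images; the sentences are quoted in `B4Thm110ZeroBox`, `B4Lemma24ZeroBoxAlphaNeg`, `B4Sect5Torus`); and
T. Bałaban, *Propagators and renormalization transformations for lattice gauge theories. II*, Commun. Math. Phys.
**96** (1984) 223–250 (`Balaban1984PropagatorsII`, «B6»), p. 229 [PDF 7] «Taking these covers for all j from 0 to k
we get a family 𝔇 of cubes □ of different sizes and such that T = ⋃□», p. 230 [PDF 8] «If □ ⊂ Bʲ(Λ_j), then the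
necessary properties of G′(□) are described in Lemma 2.2 [3]» (held text `paper:balaban1984-cmp96-propagators-rt-ii`
pp. 7–8, re-read for this file).  A new leaf next to `B4Thm110ZeroBox` / `B4Thm110ZeroBoxDeriv`; no existing module is
touched; nothing of B4 is asserted as a fact; every input is a kernel-proved theorem of the `B4*` package, USED BY NAME.

## WHY THIS FILE (row G-F3′-L0 of the lit-balaban cell, packet S-B, file F5 of `lit-balaban-r03/G-F3L0-PLAN.md` §5)

`B4Thm110ZeroBox.thm110_zero_box_roww_coeff` (:1801) and `B4Thm110ZeroBoxDeriv.thm110_zero_box_deriv_roww_coeff`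
(:985) quantify `∀ k, 1 ≤ k →` (mesh `η = L^{-k}`) because B4 p. 572 prints «k is an arbitrary positive integer»; the
two-level cube lane `B6Ineq243TwoLevelBox` (:694 ff.) inherits the binder.  [B6]'s cover of p. 229 runs over «all j
from 0 to k»: a LEVEL-0 cube `□ ⊂ B⁰(Λ₀) = Λ₀` carries `−Δ^N_□ + a₀Q₀′^*Q₀′` at UNIT scale with `Q₀′ = Q₀ = id`
((2.14)/(2.20), p. 225–226) — the `k = 0` member of B4's family (`η = 1`, `B⁰(y) = {y}`, `P₀ = Q₀^*Q₀ = 1`), a massive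
Neumann resolvent `G₀(□) = (−Δ^N_□ + m² + a)⁻¹` on the unit lattice (mass `≥ a₋ > 0`), = the `j = 0` member of B4
Lemma 2.4 ((2.44) at `ξ = 1`), whose decay is the Combes–Thomas estimate of B4 Lemma 5.2 (5.7).  This file supplies
that member and removes the binder «1 ≤ k» from the two weighted-row theorems (level-0 twins port by a name swap).

## WHAT THIS FILE CERTIFIES (kernel-checked, zero `sorry`, no hypotheses)

For every dimension `d + 1` and every window `a ∈ [a₋, a₊]` (`a₋ > 0`), `m² ∈ [0, m²₊]`, on every box
`□ = Π_μ[0, M_μ) ∩ ℤ^{d+1}` (the carrier `boxDom (fun i => 1 * M i)` of `B4BoxCov237.boxOpR 1 a m² M`):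
* §1 `boxOpR_one_eq`: at mesh `1` every block is a point, `boxOpR 1 a m² M = boxOpR 1 0 (m² + a) M = −Δ^N_□ + (m² + a)`;
  `boxOpR_one_form_ge`: `⟨v, (−Δ^N_□ + m² + a)v⟩ ≥ a‖v‖²`; `boxOpR_one_hyp56`: B4's condition (5.6)
  (`B4Sect5Torus.Hyp56`) with `γ₀ = a₋`, range-one kernel bound `c₀ = (2(d+1) + |m²₊| + |a₊|)e`, uniformly on the window;
* §2 `boxOpR_one_inv_decay` — **LEMMA 2.4 (2.35) AT `j = 0` / LEMMA 5.2 (5.7)**: `|G₀(□)(p, q)| ≤ C₀e^{−r|p − q|_∞}` with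
  `r, C₀ > 0` depending on `d` and the window only (`B4Sect5Torus.inv_decay` = [B4] Lemma 5.2, finite Combes–Thomas,
  BY NAME — the route of `B4Thm110ZeroBox.boxOpR_L_inv_decay` for the one-step operator, here for the zero-step one);
* §3 **THEOREM (1.10) AT MESH ONE**, weighted-row forms: `thm110_zero_box_roww_meshOne`
  (`Σ_{x′}|G₀(x,x′)|e^{δ₀|x−x′|_∞} ≤ c₀`), `thm110_zero_box_deriv_wsum_meshOne`
  (`Σ_{x′}|G₀(x+e_μ,x′) − G₀(x,x′)|e^{δ₀|x−x′|_∞} ≤ c₀`, the forward difference = `D^1_{0,μ}` of (1.3) at `η = 1`), and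
  the printed value forms `thm110_zero_box_value_meshOne` / `thm110_zero_box_deriv_value_meshOne`
  (`|(G₀f)(x)|, |(D_μG₀f)(x)| ≤ c₀e^{−δ₀dist(x, supp f)}‖f‖_∞`);
* §4 **THE ALL-SCALES FORMS** `thm110_zero_box_roww_coeff_all`, `thm110_zero_box_deriv_roww_coeff_all`: literally
  `B4Thm110ZeroBox.thm110_zero_box_roww_coeff` / `B4Thm110ZeroBoxDeriv.thm110_zero_box_deriv_roww_coeff` with the
  binder `1 ≤ k →` DELETED (`k = 0` from §3, `k ≥ 1` from the lineage, constants `min`/`max`-merged), plus the printed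
  value clauses `thm110_zero_box_value_coeff_all` / `thm110_zero_box_deriv_value_coeff_all` (the `ℓ^∞ → ℓ^∞` bounds of
  Lemma 2.2 (2.17) for all `k ≥ 0` follow by `B4Thm110ZeroBox.rowSum_le_roww` / `B4Thm110ZeroBoxDeriv.sum_abs_le_wsum`);
* §5 non-vacuity (`d + 1 = 4`, `L = 2`, window `a ∈ [1/2, 2]`, `m² ∈ [0, 1]`; the `k = 0` member is the unit box).

## DICTIONARY (typist's; everything at `A = 0`, `U ≡ 1`, one component, as in `B4Thm110ZeroBox`)

* `k = 0`, `η = L⁰ = 1` ↦ mesh `n = 1`: the fine box IS the unit box, `boxDom (fun i => 1 * M i)` (= `boxDom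
  (fun i => (ℓ+1)^0 * M i)` definitionally); `B⁰(y) = {y}` ↦ `blk 1 z = z`; `P₀ = Q₀^*Q₀ = 1` ↦ the averaging entry
  `avgK (a·1⁻¹) 1 x y = a·δ_{xy}`; `G₀(□) = (−Δ^{1,N}_□ + m² + aP₀)⁻¹ = (−Δ^N_□ + m² + a)⁻¹` ↦ `(boxOpR 1 a m2 M)⁻¹`.
* `dist(x, supp f)`, `|x − x′|` ↦ the sup-distance `supNorm` in lattice units (= the print's units at `η = 1`);
  `‖f‖_∞` ↦ any `F ≥ |f|`; `(D^η_{0,μ}φ)(x) = η⁻¹(φ(x + ηe_μ) − φ(x))` at `η = 1` ↦ `φ(xe) − φ(x)`, `xe = x + e_μ`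
  (the factor `((1 : ℕ) : ℝ)` is kept so that the statements are the `k = 0` instances of the lineage's).
* constants: `∃ δ₀ c₀` depending on `d` and the window only at mesh one (§§2–3); on `d`, `ℓ` and the window in §4.

## HONEST SCOPE

(i) `A = 0`, rectangular parallelepipeds `Π_μ[0, M_μ)` with integer sides, sup norm, existential constants — exactly the
scope of `B4Thm110ZeroBox` (HONEST SCOPE there), now including the mesh-one member.  (ii) B4 prints the Theorem for
«k … an arbitrary positive integer» (p. 572); the `k = 0` member certified here is the degenerate unit-lattice case
(`η = 1`, `P₀ = 1`) in which (1.10) is the decay of a massive Neumann resolvent; in print it is covered by Lemma 2.4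
(2.35) at `j = 0` («arbitrary non-negative integer j»; `(G₀(□)Q₀^*)(x, y) = G₀(□)(x, y)`) and it is the `j = 0` cube
type of [B6] p. 229–230 («If □ ⊂ Bʲ(Λ_j), then the necessary properties of G′(□) are described in Lemma 2.2 [3]»).
No claim is made that B4 states (1.10) at `k = 0` verbatim.  (iii) ROUTE: coercivity `≥ a` from the quadratic form
(`B4BoxCov237.fineEnergy_eq`), range-one kernel bound (`B4Thm110ZeroBox.boxOpR_entry_le`), then [B4] Lemma 5.2 =
`B4Sect5Torus.inv_decay` (Combes–Thomas) and the lattice sums `B4Thm110ZeroBox.roww_le_of_decay` /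
`B4Thm110ZeroBoxDeriv.wsum_le_of_decay`; the `k ≥ 1` members of §4 are the lineage's theorems verbatim.  (iv) The mass
`m² ≥ 0` is a window parameter (`m² = 0` in [B6]); the decay rate is not tracked numerically.

**Value = kernel certificate (the unit-lattice member of B4 (1.10) at `A = 0` on boxes and the all-scales weighted-row
forms the [B6] level-0 cube lane consumes), NOT summit progress**: the Yang–Mills / `Summit.QuantumFields` statements
are untouched; no Literature fact is minted.
-/

namespace Literature.MathematicalPhysics.QuantumFieldTheory.Balaban1983to89.B4Thm110ZeroBoxMeshOne

open Finset Matrix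
open Literature.MathematicalPhysics.QuantumFieldTheory.Balaban1983to89.B4ContourShift
open Literature.MathematicalPhysics.QuantumFieldTheory.Balaban1983to89.B4Reflection242
open Literature.MathematicalPhysics.QuantumFieldTheory.Balaban1983to89.B4Green242Bridge
open Literature.MathematicalPhysics.QuantumFieldTheory.Balaban1983to89.B4BoxCov237
open Literature.MathematicalPhysics.QuantumFieldTheory.Balaban1983to89.B4Thm110ZeroBox
open Literature.MathematicalPhysics.QuantumFieldTheory.Balaban1983to89.B4Thm110ZeroBoxDeriv
open B4Sect5Torus (Hyp56 rate rate_pos inv_decay)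
open B4Sect5Proof (latticeConst latticeConst_nonneg)

noncomputable section

variable {d : ℕ}

/-! ## §1 The mesh-one member: `boxOpR 1 a m² M = −Δ^N_□ + m² + a`, coercivity, condition (5.6) -/

/-- **AT MESH ONE EVERY BLOCK IS A POINT**: `B⁰(y) = {y}`, `P₀ = Q₀^*Q₀ = 1`, so B4's operator (1.6)/(2.44) at
`η = ξ = 1` is the massive Neumann resolvent operator, `boxOpR 1 a m² M = boxOpR 1 0 (m² + a) M = −Δ^N_□ + (m² + a)`.
[cite: Balaban1983RegularityDecay, (1.4)–(1.6) p.572 and (2.44) p.584 at η = ξ = 1, dictionary] -/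
theorem boxOpR_one_eq (a m2 : ℝ) (M : Fin (d + 1) → ℕ) : boxOpR 1 a m2 M = boxOpR 1 0 (m2 + a) M := by
  ext x y
  have h1 : ∀ w : Fin (d + 1) → ℤ, blk 1 w = w := fun w => by funext j; simp [blk]
  simp only [boxOpR, opBoxR, Matrix.of_apply, avgK, diagK, h1]
  by_cases hxy : y.1 = x.1
  · simp only [if_pos hxy]
    push_cast
    ring
  · simp only [if_neg hxy]

/-- **COERCIVITY OF THE MESH-ONE OPERATOR**: `⟨v, (−Δ^N_□ + m² + a)v⟩ ≥ a‖v‖²` (`m² ≥ 0`, any `a`; the bond form and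
the mass term are nonnegative, `B4BoxCov237.fineEnergy_eq`). [cite: Balaban1983RegularityDecay, (5.6) p.594 («A ≥ γ₀I»)
for the operator (1.6) p.572 at η = 1] -/
theorem boxOpR_one_form_ge (a : ℝ) {m2 : ℝ} (hm : 0 ≤ m2) (M : Fin (d + 1) → ℕ)
    (v : ↥(boxDom (fun i => 1 * M i)) → ℝ) :
    a * (v ⬝ᵥ v) ≤ v ⬝ᵥ (boxOpR 1 a m2 M) *ᵥ v := by
  rw [boxOpR_one_eq]
  have hE := fineEnergy_eq (d := d) (n := 1) le_rfl 0 (m2 + a) M v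
  simp only [zero_mul, sub_zero] at hE
  have hS : 0 ≤ ∑ x, ∑ x' ∈ boxNbrs (fun i => 1 * M i) x, (v x - v x') ^ 2 :=
    Finset.sum_nonneg fun _ _ => Finset.sum_nonneg fun _ _ => sq_nonneg _
  have hvv : v ⬝ᵥ v = ∑ x, v x ^ 2 := by
    unfold dotProduct
    exact Finset.sum_congr rfl fun p _ => by ring
  have h0 : 0 ≤ ∑ x, v x ^ 2 := Finset.sum_nonneg fun _ _ => sq_nonneg _
  have hn : (0 : ℝ) ≤ ((1 : ℕ) : ℝ) ^ 2 / 2 := by positivity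
  rw [hvv, hE]
  nlinarith [mul_nonneg hn hS, mul_nonneg hm h0]

/-- **CONDITION (5.6) FOR THE MESH-ONE OPERATOR**, uniformly on the window `a ∈ [a₋, a₊]`, `m² ∈ [0, m²₊]` and in
the box: `Hyp56 (rho) (boxOpR 1 a m² M) a₋ c₀ 1` with `c₀ = (2(d+1)·1² + |m²₊| + |a₊|)e¹` (symmetry
`B4BoxCov237.opBoxR_isSymm`, coercivity `boxOpR_one_form_ge`, range-one kernel bound
`B4Thm110ZeroBox.boxOpR_entry_le`). [cite: Balaban1983RegularityDecay, Lemma 5.2 (5.6) p.594] -/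
theorem boxOpR_one_hyp56 (d : ℕ) (amin aplus m2plus : ℝ) (ha : 0 < amin) :
    ∃ γ₀ c₀ : ℝ, 0 < γ₀ ∧ 0 ≤ c₀ ∧ ∀ (a m2 : ℝ), amin ≤ a → a ≤ aplus → 0 ≤ m2 → m2 ≤ m2plus →
      ∀ (M : Fin (d + 1) → ℕ), Hyp56 (rho (fun i => 1 * M i)) (boxOpR 1 a m2 M) γ₀ c₀ 1 := by
  refine ⟨amin, (2 * ((d : ℝ) + 1) * (((1 : ℕ) : ℝ)) ^ 2 + |m2plus| + |aplus|) * Real.exp (((1 : ℕ) : ℝ)),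
    ha, by positivity, ?_⟩
  intro a m2 h1 h2 h3 h4 M
  have ha0 : 0 ≤ a := ha.le.trans h1
  refine ⟨opBoxR_isSymm _ _ _ _ _, fun v => ?_, fun p q => boxOpR_entry_le le_rfl ha0 h2 h3 h4 M p q⟩
  have hvv : ∑ p, v p ^ 2 = v ⬝ᵥ v := by
    unfold dotProduct
    exact Finset.sum_congr rfl fun p _ => by ring
  have hvv0 : 0 ≤ v ⬝ᵥ v := by
    rw [← hvv]
    exact Finset.sum_nonneg fun _ _ => sq_nonneg _
  rw [hvv]
  show _ * (v ⬝ᵥ v) ≤ v ⬝ᵥ (boxOpR 1 a m2 M).mulVec v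
  exact (mul_le_mul_of_nonneg_right h1 hvv0).trans (boxOpR_one_form_ge a h3 M v)

/-! ## §2 LEMMA 2.4 (2.35) at `j = 0` / LEMMA 5.2 (5.7): the entry decay of `G₀(□) = (−Δ^N_□ + m² + a)⁻¹` -/

/-- **EXPONENTIAL DECAY OF THE MESH-ONE NEUMANN GREEN'S FUNCTION** `G₀(□) = (−Δ^N_□ + m² + a)⁻¹`, uniformly on the
window and in the box: `|G₀(□)(p, q)| ≤ C₀e^{−r|p − q|_∞}` with `r, C₀ > 0` depending on `d` and the window only —
[B4] Lemma 2.4 (2.35) at `j = 0` (`(G₀(□)Q₀^*)(x, y) = G₀(□)(x, y)`), obtained as [B4] Lemma 5.2 (5.7)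
(`B4Sect5Torus.inv_decay`, finite Combes–Thomas, BY NAME) from condition (5.6) (`boxOpR_one_hyp56`).
[cite: Balaban1983RegularityDecay, Lemma 2.4 (2.35) p.582 at j = 0 («arbitrary non-negative integer j»); Lemma 5.2
(5.7) p.594] -/
theorem boxOpR_one_inv_decay (d : ℕ) (amin aplus m2plus : ℝ) (ha : 0 < amin) :
    ∃ r C₀ : ℝ, 0 < r ∧ 0 < C₀ ∧ ∀ (a m2 : ℝ), amin ≤ a → a ≤ aplus → 0 ≤ m2 → m2 ≤ m2plus →
      ∀ (M : Fin (d + 1) → ℕ) (p q : ↥(boxDom (fun i => 1 * M i))),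
        |(boxOpR 1 a m2 M)⁻¹ p q| ≤ C₀ * Real.exp (-(r * supNorm (p.1 - q.1))) := by
  obtain ⟨γ₀, c₀, hγ, hc, h⟩ := boxOpR_one_hyp56 d amin aplus m2plus ha
  have hK : ∀ t : ℝ, 0 < t → 0 ≤ latticeConst (d + 1) t := fun t ht => latticeConst_nonneg _ ht.le
  refine ⟨rate (latticeConst (d + 1)) γ₀ c₀ 1, 2 / γ₀, rate_pos hK hγ hc one_pos, by positivity, ?_⟩
  intro a m2 h1 h2 h3 h4 M p q
  have hd := inv_decay hK hγ hc one_pos (rho_isPseudoDist _) (rho_sumBound _) (h a m2 h1 h2 h3 h4 M) p q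
  unfold rho at hd
  exact hd

/-! ## §3 THEOREM (1.10) AT MESH ONE: weighted rows of `G₀(□)` and of its forward differences; the printed forms -/

/-- **THEOREM (1.10), VALUE CLAUSE, AT MESH ONE** (weighted-row form): there are `δ₀, c₀ > 0` depending on `d` and
the window only such that for every `(a, m²)` in the window, every box and every `x`:
`Σ_{x′ ∈ □}|G₀(□)(x, x′)|e^{δ₀|x − x′|_∞} ≤ c₀` (`roww δ₀ 1`; from `boxOpR_one_inv_decay` through
`B4Thm110ZeroBox.roww_le_of_decay`, `δ₀ = r/2`, `c₀ = C₀K_{d+1}(r/2)`).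
[cite: Balaban1983RegularityDecay, Theorem (Prop. 2.1 of [1]) (1.10) p.573 with (1.6) p.572, at η = 1] -/
theorem thm110_zero_box_roww_meshOne (d : ℕ) (amin aplus m2plus : ℝ) (ha : 0 < amin) :
    ∃ δ₀ c₀ : ℝ, 0 < δ₀ ∧ 0 < c₀ ∧ ∀ (a m2 : ℝ), amin ≤ a → a ≤ aplus → 0 ≤ m2 → m2 ≤ m2plus →
      ∀ (M : Fin (d + 1) → ℕ) (x : ↥(boxDom (fun i => 1 * M i))), roww δ₀ 1 (boxOpR 1 a m2 M)⁻¹ x ≤ c₀ := by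
  obtain ⟨r, C₀, hr, hC, h⟩ := boxOpR_one_inv_decay d amin aplus m2plus ha
  have hK1 : 1 ≤ latticeConst (d + 1) (r / 2) := one_le_latticeConst d (half_pos hr)
  refine ⟨r / 2, C₀ * latticeConst (d + 1) (r / 2), half_pos hr, mul_pos hC (lt_of_lt_of_le one_pos hK1), ?_⟩
  intro a m2 h1 h2 h3 h4 M x
  exact roww_le_of_decay le_rfl hC.le hr (half_pos hr).le le_rfl (fun p q => h a m2 h1 h2 h3 h4 M p q) x

/-- **THEOREM (1.10), DERIVATIVE CLAUSE, AT MESH ONE** (weighted form): there are `δ₀, c₀ > 0` depending on `d` and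
the window only such that for every `(a, m²)` in the window, every box, every axis `μ` and every pair of lattice
neighbours `x, xe = x + e_μ` in `□`:  `Σ_{x′ ∈ □}|1·(G₀(□)(x + e_μ, x′) − G₀(□)(x, x′))|e^{δ₀|x − x′|_∞} ≤ c₀`
(`wsum δ₀ 1`; both entries decay by `boxOpR_one_inv_decay` and `|xe − x′|_∞ ≥ |x − x′|_∞ − 1`, then
`B4Thm110ZeroBoxDeriv.wsum_le_of_decay`; `c₀ = C₀(e^r + 1)K_{d+1}(r/2)`).
[cite: Balaban1983RegularityDecay, Theorem (Prop. 2.1 of [1]) (1.10) p.573 (derivative clause, (1.3) at A = 0), at η = 1] -/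
theorem thm110_zero_box_deriv_wsum_meshOne (d : ℕ) (amin aplus m2plus : ℝ) (ha : 0 < amin) :
    ∃ δ₀ c₀ : ℝ, 0 < δ₀ ∧ 0 < c₀ ∧ ∀ (a m2 : ℝ), amin ≤ a → a ≤ aplus → 0 ≤ m2 → m2 ≤ m2plus →
      ∀ (M : Fin (d + 1) → ℕ) (μ : Fin (d + 1)) (x xe : ↥(boxDom (fun i => 1 * M i))),
        xe.1 = x.1 + Pi.single μ 1 →
          wsum δ₀ 1 x (fun x' => (((1 : ℕ)) : ℝ) * ((boxOpR 1 a m2 M)⁻¹ xe x' - (boxOpR 1 a m2 M)⁻¹ x x'))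
            ≤ c₀ := by
  obtain ⟨r, C₀, hr, hC, h⟩ := boxOpR_one_inv_decay d amin aplus m2plus ha
  have hK1 : 1 ≤ latticeConst (d + 1) (r / 2) := one_le_latticeConst d (half_pos hr)
  have hC' : 0 < C₀ * (Real.exp r + 1) := by positivity
  refine ⟨r / 2, C₀ * (Real.exp r + 1) * latticeConst (d + 1) (r / 2), half_pos hr,
    mul_pos hC' (lt_of_lt_of_le one_pos hK1), ?_⟩
  intro a m2 h1 h2 h3 h4 M μ x xe hxe
  refine wsum_le_of_decay le_rfl x hC'.le hr (half_pos hr).le le_rfl fun x' => ?_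
  have hxe' := h a m2 h1 h2 h3 h4 M xe x'
  have hx' := h a m2 h1 h2 h3 h4 M x x'
  have hdist : supNorm (x.1 - x'.1) ≤ supNorm (xe.1 - x'.1) + 1 := supNorm_sub_le_nbr hxe
  have hexp : Real.exp (-(r * supNorm (xe.1 - x'.1))) ≤ Real.exp r * Real.exp (-(r * supNorm (x.1 - x'.1))) := by
    rw [← Real.exp_add]
    exact Real.exp_le_exp.2 (by nlinarith)
  rw [Nat.cast_one, one_mul]
  calc |(boxOpR 1 a m2 M)⁻¹ xe x' - (boxOpR 1 a m2 M)⁻¹ x x'|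
      ≤ |(boxOpR 1 a m2 M)⁻¹ xe x'| + |(boxOpR 1 a m2 M)⁻¹ x x'| := abs_sub _ _
    _ ≤ C₀ * Real.exp (-(r * supNorm (xe.1 - x'.1))) + C₀ * Real.exp (-(r * supNorm (x.1 - x'.1))) :=
        add_le_add hxe' hx'
    _ ≤ C₀ * (Real.exp r * Real.exp (-(r * supNorm (x.1 - x'.1))))
          + C₀ * Real.exp (-(r * supNorm (x.1 - x'.1))) :=
        add_le_add (mul_le_mul_of_nonneg_left hexp hC.le) le_rfl
    _ = C₀ * (Real.exp r + 1) * Real.exp (-(r * supNorm (x.1 - x'.1))) := by ring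

/-- **THEOREM (1.10) AT MESH ONE — THE PRINTED VALUE CLAUSE** `|(G₀(□)f)(x)| ≤ c₀e^{−δ₀dist(x, supp f)}‖f‖_∞`: for
every `f : □ → ℝ`, every bound `F ≥ |f|` and every `D ≤ |x − x′|_∞` on `supp f`, `|(G₀f)(x)| ≤ c₀e^{−δ₀D}F`.
[cite: Balaban1983RegularityDecay, Theorem (Prop. 2.1 of [1]) (1.10) p.573, at η = 1] -/
theorem thm110_zero_box_value_meshOne (d : ℕ) (amin aplus m2plus : ℝ) (ha : 0 < amin) :
    ∃ δ₀ c₀ : ℝ, 0 < δ₀ ∧ 0 < c₀ ∧ ∀ (a m2 : ℝ), amin ≤ a → a ≤ aplus → 0 ≤ m2 → m2 ≤ m2plus →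
      ∀ (M : Fin (d + 1) → ℕ) (f : ↥(boxDom (fun i => 1 * M i)) → ℝ) (F D : ℝ), (∀ x', |f x'| ≤ F) →
      ∀ x : ↥(boxDom (fun i => 1 * M i)), (∀ x', f x' ≠ 0 → D ≤ supNorm (x.1 - x'.1)) →
        |((boxOpR 1 a m2 M)⁻¹ *ᵥ f) x| ≤ c₀ * Real.exp (-(δ₀ * D)) * F := by
  obtain ⟨δ₀, c₀, hδ, hc, h⟩ := thm110_zero_box_roww_meshOne d amin aplus m2plus ha
  refine ⟨δ₀, c₀, hδ, hc, ?_⟩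
  intro a m2 h1 h2 h3 h4 M f F D hF x hD
  have := mulVec_le_of_roww hδ.le 1 _ x (h a m2 h1 h2 h3 h4 M x) f hF hD
  simpa using this

/-- **THEOREM (1.10) AT MESH ONE — THE PRINTED DERIVATIVE CLAUSE** `|(D_μG₀(□)f)(x)| ≤ c₀e^{−δ₀dist(x, supp f)}‖f‖_∞`,
`(D_μφ)(x) = φ(x + e_μ) − φ(x)`: for every `f`, `F ≥ |f|`, axis `μ`, neighbours `x, xe = x + e_μ` in `□` and every
`D ≤ |x − x′|_∞` on `supp f`, `|(G₀f)(xe) − (G₀f)(x)| ≤ c₀e^{−δ₀D}F`.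
[cite: Balaban1983RegularityDecay, Theorem (Prop. 2.1 of [1]) (1.10) p.573 (derivative clause), at η = 1] -/
theorem thm110_zero_box_deriv_value_meshOne (d : ℕ) (amin aplus m2plus : ℝ) (ha : 0 < amin) :
    ∃ δ₀ c₀ : ℝ, 0 < δ₀ ∧ 0 < c₀ ∧ ∀ (a m2 : ℝ), amin ≤ a → a ≤ aplus → 0 ≤ m2 → m2 ≤ m2plus →
      ∀ (M : Fin (d + 1) → ℕ) (f : ↥(boxDom (fun i => 1 * M i)) → ℝ) (F D : ℝ), (∀ x', |f x'| ≤ F) →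
      ∀ (μ : Fin (d + 1)) (x xe : ↥(boxDom (fun i => 1 * M i))), xe.1 = x.1 + Pi.single μ 1 →
        (∀ x', f x' ≠ 0 → D ≤ supNorm (x.1 - x'.1)) →
          |((boxOpR 1 a m2 M)⁻¹ *ᵥ f) xe - ((boxOpR 1 a m2 M)⁻¹ *ᵥ f) x| ≤ c₀ * Real.exp (-(δ₀ * D)) * F := by
  obtain ⟨δ₀, c₀, hδ, hc, h⟩ := thm110_zero_box_deriv_wsum_meshOne d amin aplus m2plus ha
  refine ⟨δ₀, c₀, hδ, hc, ?_⟩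
  intro a m2 h1 h2 h3 h4 M f F D hF μ x xe hxe hD
  have h1' := abs_sum_mul_le_of_wsum hδ.le 1 x _ (h a m2 h1 h2 h3 h4 M μ x xe hxe) f hF hD
  rw [← mulVec_sub_mulVec] at h1'
  simpa using h1'

/-! ## §4 THE ALL-SCALES FORMS (`k ≥ 0`): the lineage's weighted-row theorems with the binder «1 ≤ k» removed -/

/-- **THEOREM (1.10) AT `A = 0` FOR BOXES WITH THE LITERAL COEFFICIENT `a` OF (1.6), ALL SCALES `k ≥ 0`**: the uniform
weighted row bound `Σ_{x′}|G(x,x′)|e^{δ₀|x−x′|_∞/L^k} ≤ c₀` for `G = (−Δ^{η,N}_□ + m² + aP_k)⁻¹`, `η = L^{-k}`, `a` in the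
window `[a₋, a₊]`, `m² ∈ [0, m²₊]`, every box and every point — `B4Thm110ZeroBox.thm110_zero_box_roww_coeff` for
`k ≥ 1` and `thm110_zero_box_roww_meshOne` for `k = 0`, with `δ₀ = min`, `c₀ = max` of the two pairs of constants.
[cite: Balaban1983RegularityDecay, Theorem (Prop. 2.1 of [1]) (1.10) p.573 with (1.6) p.572; Lemma 2.4 (2.35) p.582 at j = 0] -/
theorem thm110_zero_box_roww_coeff_all (d ℓ : ℕ) (hℓ : 1 ≤ ℓ) (amin aplus m2plus : ℝ) (ha : 0 < amin) :
    ∃ δ₀ c₀ : ℝ, 0 < δ₀ ∧ 0 < c₀ ∧ ∀ (k : ℕ) (a m2 : ℝ), amin ≤ a → a ≤ aplus → 0 ≤ m2 →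
      m2 ≤ m2plus → ∀ (M : Fin (d + 1) → ℕ), (∀ i, 1 ≤ M i) → ∀ x : ↥(boxDom (fun i => (ℓ + 1) ^ k * M i)),
        ∑ x', |(boxOpR ((ℓ + 1) ^ k) a m2 M)⁻¹ x x'|
            * Real.exp (δ₀ * supNorm (x.1 - x'.1) / (((ℓ + 1) ^ k : ℕ) : ℝ)) ≤ c₀ := by
  obtain ⟨δ₁, c₁, hδ₁, hc₁, h₁⟩ := thm110_zero_box_roww_coeff d ℓ hℓ amin aplus m2plus ha
  obtain ⟨δ₂, c₂, hδ₂, hc₂, h₂⟩ := thm110_zero_box_roww_meshOne d amin aplus m2plus ha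
  have mono : ∀ {N : Fin (d + 1) → ℕ} {δ δ' : ℝ}, δ' ≤ δ → ∀ (n : ℕ) (T : Matrix ↥(boxDom N) ↥(boxDom N) ℝ)
      (z : ↥(boxDom N)), roww δ' n T z ≤ roww δ n T z := by
    intro N δ δ' hle n T z
    unfold roww
    refine Finset.sum_le_sum fun z' _ => mul_le_mul_of_nonneg_left ?_ (abs_nonneg _)
    exact Real.exp_le_exp.2 (div_le_div_of_nonneg_right
      (mul_le_mul_of_nonneg_right hle (supNorm_nonneg _)) (Nat.cast_nonneg n))
  refine ⟨min δ₁ δ₂, max c₁ c₂, lt_min hδ₁ hδ₂, lt_max_of_lt_left hc₁, ?_⟩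
  intro k
  rcases Nat.eq_zero_or_pos k with rfl | hk
  · intro a m2 h1 h2 h3 h4 M _ x
    have hx := h₂ a m2 h1 h2 h3 h4 M x
    have hm := mono (min_le_right δ₁ δ₂) 1 (boxOpR 1 a m2 M)⁻¹ x
    have : roww (min δ₁ δ₂) 1 (boxOpR 1 a m2 M)⁻¹ x ≤ max c₁ c₂ := (hm.trans hx).trans (le_max_right _ _)
    unfold roww at this
    exact this
  · intro a m2 h1 h2 h3 h4 M hM x
    have hx := h₁ k hk a m2 h1 h2 h3 h4 M hM x
    have hm := mono (min_le_left δ₁ δ₂) ((ℓ + 1) ^ k) (boxOpR ((ℓ + 1) ^ k) a m2 M)⁻¹ x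
    unfold roww at hm
    exact (hm.trans hx).trans (le_max_left _ _)

/-- **THEOREM (1.10), DERIVATIVE CLAUSE, AT `A = 0` FOR BOXES WITH THE LITERAL COEFFICIENT, ALL SCALES `k ≥ 0`**:
`Σ_{x′}|η⁻¹(G(x + ηe_μ, x′) − G(x, x′))|e^{δ₀|x−x′|_∞/L^k} ≤ c₀` for every `k ≥ 0`, `(a, m²)` in the window, every box,
axis and pair of fine neighbours — `B4Thm110ZeroBoxDeriv.thm110_zero_box_deriv_roww_coeff` (`k ≥ 1`) and
`thm110_zero_box_deriv_wsum_meshOne` (`k = 0`), constants merged.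
[cite: Balaban1983RegularityDecay, Theorem (Prop. 2.1 of [1]) (1.10) p.573 with (1.6) p.572; Lemma 2.4 (2.35) p.582 at j = 0] -/
theorem thm110_zero_box_deriv_roww_coeff_all (d ℓ : ℕ) (hℓ : 1 ≤ ℓ) (amin aplus m2plus : ℝ) (ha : 0 < amin) :
    ∃ δ₀ c₀ : ℝ, 0 < δ₀ ∧ 0 < c₀ ∧ ∀ (k : ℕ) (a m2 : ℝ), amin ≤ a → a ≤ aplus → 0 ≤ m2 →
      m2 ≤ m2plus → ∀ (M : Fin (d + 1) → ℕ), (∀ i, 1 ≤ M i) →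
        ∀ (μ : Fin (d + 1)) (x xe : ↥(boxDom (fun i => (ℓ + 1) ^ k * M i))), xe.1 = x.1 + Pi.single μ 1 →
          ∑ x', |(((ℓ + 1) ^ k : ℕ) : ℝ) *
                ((boxOpR ((ℓ + 1) ^ k) a m2 M)⁻¹ xe x' - (boxOpR ((ℓ + 1) ^ k) a m2 M)⁻¹ x x')|
              * Real.exp (δ₀ * supNorm (x.1 - x'.1) / (((ℓ + 1) ^ k : ℕ) : ℝ)) ≤ c₀ := by
  obtain ⟨δ₁, c₁, hδ₁, hc₁, h₁⟩ := thm110_zero_box_deriv_roww_coeff d ℓ hℓ amin aplus m2plus ha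
  obtain ⟨δ₂, c₂, hδ₂, hc₂, h₂⟩ := thm110_zero_box_deriv_wsum_meshOne d amin aplus m2plus ha
  have mono : ∀ {N : Fin (d + 1) → ℕ} {δ δ' : ℝ}, δ' ≤ δ → ∀ (n : ℕ) (z : ↥(boxDom N)) (g : ↥(boxDom N) → ℝ),
      wsum δ' n z g ≤ wsum δ n z g := by
    intro N δ δ' hle n z g
    unfold wsum
    refine Finset.sum_le_sum fun z' _ => mul_le_mul_of_nonneg_left ?_ (abs_nonneg _)
    exact Real.exp_le_exp.2 (div_le_div_of_nonneg_right
      (mul_le_mul_of_nonneg_right hle (supNorm_nonneg _)) (Nat.cast_nonneg n))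
  refine ⟨min δ₁ δ₂, max c₁ c₂, lt_min hδ₁ hδ₂, lt_max_of_lt_left hc₁, ?_⟩
  intro k
  rcases Nat.eq_zero_or_pos k with rfl | hk
  · intro a m2 h1 h2 h3 h4 M _ μ x xe hxe
    have hx := h₂ a m2 h1 h2 h3 h4 M μ x xe hxe
    have hm := mono (min_le_right δ₁ δ₂) 1 x
      (fun x' => (((1 : ℕ)) : ℝ) * ((boxOpR 1 a m2 M)⁻¹ xe x' - (boxOpR 1 a m2 M)⁻¹ x x'))
    have : wsum (min δ₁ δ₂) 1 x
        (fun x' => (((1 : ℕ)) : ℝ) * ((boxOpR 1 a m2 M)⁻¹ xe x' - (boxOpR 1 a m2 M)⁻¹ x x')) ≤ max c₁ c₂ :=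
      (hm.trans hx).trans (le_max_right _ _)
    unfold wsum at this
    exact this
  · intro a m2 h1 h2 h3 h4 M hM μ x xe hxe
    have hx := h₁ k hk a m2 h1 h2 h3 h4 M hM μ x xe hxe
    have hm := mono (min_le_left δ₁ δ₂) ((ℓ + 1) ^ k) x
      (fun x' => (((ℓ + 1) ^ k : ℕ) : ℝ) *
        ((boxOpR ((ℓ + 1) ^ k) a m2 M)⁻¹ xe x' - (boxOpR ((ℓ + 1) ^ k) a m2 M)⁻¹ x x'))
    unfold wsum at hm
    exact (hm.trans hx).trans (le_max_left _ _)

/-- **THE PRINTED VALUE CLAUSE OF (1.10) WITH THE LITERAL COEFFICIENT, ALL SCALES `k ≥ 0`**: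
`|(Gf)(x)| ≤ c₀e^{−δ₀ηD}F` for every `F ≥ |f|` and every `D ≤ |x − x′|_∞` on `supp f` (fine-lattice units).
[cite: Balaban1983RegularityDecay, Theorem (Prop. 2.1 of [1]) (1.10) p.573 with (1.6) p.572] -/
theorem thm110_zero_box_value_coeff_all (d ℓ : ℕ) (hℓ : 1 ≤ ℓ) (amin aplus m2plus : ℝ) (ha : 0 < amin) :
    ∃ δ₀ c₀ : ℝ, 0 < δ₀ ∧ 0 < c₀ ∧ ∀ (k : ℕ) (a m2 : ℝ), amin ≤ a → a ≤ aplus → 0 ≤ m2 →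
      m2 ≤ m2plus → ∀ (M : Fin (d + 1) → ℕ), (∀ i, 1 ≤ M i) →
      ∀ (f : ↥(boxDom (fun i => (ℓ + 1) ^ k * M i)) → ℝ) (F D : ℝ), (∀ x', |f x'| ≤ F) →
      ∀ x : ↥(boxDom (fun i => (ℓ + 1) ^ k * M i)), (∀ x', f x' ≠ 0 → D ≤ supNorm (x.1 - x'.1)) →
        |((boxOpR ((ℓ + 1) ^ k) a m2 M)⁻¹ *ᵥ f) x|
          ≤ c₀ * Real.exp (-(δ₀ * D / (((ℓ + 1) ^ k : ℕ) : ℝ))) * F := by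
  obtain ⟨δ₀, c₀, hδ0, hc0, h⟩ := thm110_zero_box_roww_coeff_all d ℓ hℓ amin aplus m2plus ha
  refine ⟨δ₀, c₀, hδ0, hc0, ?_⟩
  intro k a m2 h1 h2 h3 h4 M hM f F D hF x hD
  exact mulVec_le_of_roww hδ0.le _ _ x (h k a m2 h1 h2 h3 h4 M hM x) f hF hD

/-- **THE PRINTED DERIVATIVE CLAUSE OF (1.10) WITH THE LITERAL COEFFICIENT, ALL SCALES `k ≥ 0`**:
`|η⁻¹((Gf)(x + ηe_μ) − (Gf)(x))| ≤ c₀e^{−δ₀ηD}F`.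
[cite: Balaban1983RegularityDecay, Theorem (Prop. 2.1 of [1]) (1.10) p.573 with (1.6) p.572] -/
theorem thm110_zero_box_deriv_value_coeff_all (d ℓ : ℕ) (hℓ : 1 ≤ ℓ) (amin aplus m2plus : ℝ) (ha : 0 < amin) :
    ∃ δ₀ c₀ : ℝ, 0 < δ₀ ∧ 0 < c₀ ∧ ∀ (k : ℕ) (a m2 : ℝ), amin ≤ a → a ≤ aplus → 0 ≤ m2 →
      m2 ≤ m2plus → ∀ (M : Fin (d + 1) → ℕ), (∀ i, 1 ≤ M i) →
      ∀ (f : ↥(boxDom (fun i => (ℓ + 1) ^ k * M i)) → ℝ) (F D : ℝ), (∀ x', |f x'| ≤ F) →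
      ∀ (μ : Fin (d + 1)) (x xe : ↥(boxDom (fun i => (ℓ + 1) ^ k * M i))), xe.1 = x.1 + Pi.single μ 1 →
        (∀ x', f x' ≠ 0 → D ≤ supNorm (x.1 - x'.1)) →
        |(((ℓ + 1) ^ k : ℕ) : ℝ) *
            (((boxOpR ((ℓ + 1) ^ k) a m2 M)⁻¹ *ᵥ f) xe - ((boxOpR ((ℓ + 1) ^ k) a m2 M)⁻¹ *ᵥ f) x)|
          ≤ c₀ * Real.exp (-(δ₀ * D / (((ℓ + 1) ^ k : ℕ) : ℝ))) * F := by
  obtain ⟨δ₀, c₀, hδ0, hc0, h⟩ := thm110_zero_box_deriv_roww_coeff_all d ℓ hℓ amin aplus m2plus ha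
  refine ⟨δ₀, c₀, hδ0, hc0, ?_⟩
  intro k a m2 h1 h2 h3 h4 M hM f F D hF μ x xe hxe hD
  rw [mulVec_sub_mulVec]
  exact abs_sum_mul_le_of_wsum hδ0.le _ x _ (h k a m2 h1 h2 h3 h4 M hM μ x xe hxe) f hF hD

/-! ## §5 Non-vacuity: the hypotheses are met (`d + 1 = 4`, `L = 2`, window `a ∈ [1/2, 2]`, `m² ∈ [0, 1]`) -/

/-- the all-scales value theorem at the physical dimension `d + 1 = 4`, `L = 2`. -/
example : ∃ δ₀ c₀ : ℝ, 0 < δ₀ ∧ 0 < c₀ ∧ ∀ (k : ℕ) (a m2 : ℝ), (1 / 2 : ℝ) ≤ a → a ≤ 2 → 0 ≤ m2 →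
      m2 ≤ 1 → ∀ (M : Fin (3 + 1) → ℕ), (∀ i, 1 ≤ M i) → ∀ x : ↥(boxDom (fun i => (1 + 1) ^ k * M i)),
        ∑ x', |(boxOpR ((1 + 1) ^ k) a m2 M)⁻¹ x x'|
            * Real.exp (δ₀ * supNorm (x.1 - x'.1) / (((1 + 1) ^ k : ℕ) : ℝ)) ≤ c₀ :=
  thm110_zero_box_roww_coeff_all 3 1 le_rfl (1 / 2) 2 1 (by norm_num)

/-- the mesh-one entry decay at `d + 1 = 4`, window `a ∈ [1/2, 2]`, `m² ∈ [0, 1]`. -/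
example : ∃ r C₀ : ℝ, 0 < r ∧ 0 < C₀ ∧ ∀ (a m2 : ℝ), (1 / 2 : ℝ) ≤ a → a ≤ 2 → 0 ≤ m2 → m2 ≤ 1 →
      ∀ (M : Fin (3 + 1) → ℕ) (p q : ↥(boxDom (fun i => 1 * M i))),
        |(boxOpR 1 a m2 M)⁻¹ p q| ≤ C₀ * Real.exp (-(r * supNorm (p.1 - q.1))) :=
  boxOpR_one_inv_decay 3 (1 / 2) 2 1 (by norm_num)

/-- the quantifier prefix of the mesh-one theorems is inhabited: `a = 1`, `m² = 0`, the cube `M ≡ 2` (so the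
`k = 0` box is `{0,1}^4 = boxDom (fun i => (1+1)^0 * 2)`), the axis `μ = 0` and the neighbours `x = 0`, `xe = e_0`. -/
example : (1 / 2 : ℝ) ≤ 1 ∧ (1 : ℝ) ≤ 2 ∧ (0 : ℝ) ≤ 0 ∧ (0 : ℝ) ≤ 1 ∧ (∀ i : Fin (3 + 1), 1 ≤ (fun _ => 2 : Fin (3 + 1) → ℕ) i)
    ∧ (fun _ => (0 : ℤ)) ∈ boxDom (fun i : Fin (3 + 1) => (1 + 1) ^ 0 * (fun _ => 2 : Fin (3 + 1) → ℕ) i)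
    ∧ (Pi.single (0 : Fin (3 + 1)) (1 : ℤ)) ∈ boxDom (fun i : Fin (3 + 1) => (1 + 1) ^ 0 * (fun _ => 2 : Fin (3 + 1) → ℕ) i)
    ∧ (Pi.single (0 : Fin (3 + 1)) (1 : ℤ) : Fin (3 + 1) → ℤ) = (fun _ => (0 : ℤ)) + Pi.single 0 1 := by
  refine ⟨by norm_num, by norm_num, le_rfl, by norm_num, fun _ => by norm_num, ?_, ?_, by funext i; simp⟩
  · exact mem_boxDom.2 fun _ => ⟨le_rfl, by norm_num⟩
  · refine mem_boxDom.2 fun i => ?_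
    by_cases h : i = 0
    · subst h; simp
    · simp [h]

end

end Literature.MathematicalPhysics.QuantumFieldTheory.Balaban1983to89.B4Thm110ZeroBoxMeshOne
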